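import Summits.BirchSwinnertonDyer.BirchSwinnertonDyer.Theorems.SylvesterTwoHeegnerIndexUpperOffV0DescentTwoOfLeaves
import HarnessLib

/-!
# K7t crux `UpperOffV0HSYPlus` (item 19804): GLOBAL RIGIDITY from the leaves — Gross's Claim 10.1
# AT `p = 2` for `y² = x³ − c`: `Sel₂(E/K)` is fixed by complex conjugation

Route `SylvesterTwoHeegnerIndex` (cell bsd-cm, rung K7t), line `offv0-kolyvagin2`, k7t-c2 g7.  Assembly
twin of k7t-c2 g4's `descentTwo_of_leaves` (`…UpperOffV0DescentTwoOfLeaves`): the SAME data — `K`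
imaginary quadratic with conjugation `c`, a `ℚ`-model `W` of `y² = x³ − c_M` with `∛c_M ∉ K`, `ω ∉ K`,
`E(K)[2] = 0`, a point `P` with its sign `ε` (Gross Prop. 5.3), leaf (A) (`cl`, `hc1`, `hcl`: the
classes `c_M(m)` with McCallum (6), Prop. 4.4, Gross Prop. 5.4 (2) — the shape produced from the
registered stub (d″)) — with two changes: (i) `P` is NOT divisible by `2` (`M₀ = 0`:
`2^{M-1}·δ_M P ≠ 0`); (ii) leaf (B) is taken in RIGIDITY form (`hrig`: at a Kolyvagin prime where a
`ν`-eigenclass `d`, Selmer-local off `ℓ`, has FULL order, `s − c_*s` is locally trivial for every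
Selmer `s` with `2s = 0` — the output shape of `sub_conjAct_mem_torsionLocalKer_of_reciprocity_two`,
`…UpperOffV0RigidityTwo`, i.e. of the registered stub (e) through the `2`-torsion-layer algebra of
`…UpperOffV0LevelOneIsotropy`).  Output (`conjAct_eq_self_of_leaves_two`): **every `s ∈ S_{2^M}(E/K)`
with `2s = 0` satisfies `c_* s = s`** — the `2`-Selmer group of `E` over `K` is pointwise fixed by
complex conjugation (Gross's Claim 10.1 "`Sel^{−ε} = 0`" at `p = 2`), the Čebotarev inputs being the
tree's `exists_kolyvaginPrime_gt_twoPow_holds` (Cor. 3.2 at `2`, k7t-c2 g3).  By ISOTROPY / EXACTNESS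
(`…LevelOneIsotropy`) this is ALL the leaves say about `2`-torsion Selmer classes.  NOT the crux
(B14 = O12 open as a class); no definition, no named fact, no sorry.
-/

noncomputable section

open scoped Classical
open WeierstrassCurve NumberField IsDedekindDomain Field Literature.NumberTheory.EllipticCurves
  Literature.NumberTheory.GaloisRepresentations

set_option autoImplicit false
set_option linter.dupNamespace false

namespace Summit.BirchSwinnertonDyer.BirchSwinnertonDyer.Theorems.SylvesterTwoUpper

universe u

variable {N : ℕ} [NeZero N] {W : WeierstrassCurve ℚ} {K : Type u} [Field K] [NumberField K]

set_option maxHeartbeats 800000 in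
/-- **Gross's Claim 10.1 at `p = 2` from the leaves, for `y² = x³ − c`: `c_* s = s` for every
`s ∈ S_{2^M}(E/K)` with `2s = 0`, when the Heegner point is not divisible by `2`.**  Inputs as in
`descentTwo_of_leaves` with `M₀ = 0` (`hxord`: `2^{M-1} δ_M P ≠ 0`) and leaf (B) in rigidity form
(`hrig`).  Proof (Gross §10 with `p = 2`): `d := s − c_*s` is a `(−1)`-eigenclass with `2d = 0`; by
leaf (A) at `m = ℓ` and `hrig`, `d_λ = 0` at every Kolyvagin prime `ℓ` of level `M` with
`(2^{M-1}δ_M P)_λ ≠ 0`; Cor. 3.2 at `2` for the eigen-family `{δ_M P, d}` (or `{δ_M P}` when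
`d ∈ ℤ·δ_M P`, where `d ≠ 0` forces `d = 2^{M-1}δ_M P` up to an odd factor) produces such an `ℓ` with
`d_λ ≠ 0` unless `d = 0`. [cite: GrossLMS1991, §10 Claim 10.1, Props. 9.5, 10.2]
[cite: McCallumLMS1991, §3 Cor. 3.2] -/
theorem conjAct_eq_self_of_leaves_two [W.IsElliptic] (hK : IsImaginaryQuadratic K)
    {C : VariableChange ℚ} {cM : ℚ} (hCW : C • W = ⟨0, 0, 0, 0, -cM⟩)
    (hcube : ∀ x : K, x ^ 3 ≠ (cM : K)) (hωK : ∀ x : K, x ^ 2 + x + 1 ≠ 0)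
    {P : (W.baseChange K).toAffine.Point} {M : ℕ} (hM : 1 ≤ M)
    (hdiv : ∀ Q : geomPoints (W.baseChange K), ∃ R, ((2 ^ M : ℕ) : ℤ) • R = Q)
    {c : K ≃ₐ[ℚ] K} (hc : c ≠ 1) (hcc : c * c = 1)
    (hA2 : ∀ a : (W.baseChange K).toAffine.Point, 2 • a = 0 → a = 0)
    (hxord : (((2 : ℕ) : ℤ) ^ (M - 1)) • kummerMapTorsion (W.baseChange K) _ hdiv P ≠ 0)
    (ε : ℤ) (hε : ε = 1 ∨ ε = -1)
    (h53 : IsOfFinAddOrder (Affine.Point.map (W' := W) (c : K →ₐ[ℚ] K) P - ε • P))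
    (cl : ℕ → galH1Torsion (W.baseChange K) ((2 ^ M : ℕ) : ℤ))
    (hc1 : cl 1 = kummerMapTorsion (W.baseChange K) _ hdiv P)
    (hcl : ∀ m : ℕ, Squarefree m →
      (∀ q ∈ m.primeFactors, IsKolyvaginPrime N W K 2 q ∧ FrobEqFrobInfty W K (2 ^ M) q) →
      conjAct W c _ (cl m) = (ε * (-1) ^ m.primeFactors.card) • cl m ∧
      (∀ v : HeightOneSpectrum (𝓞 K), (m : 𝓞 K) ∉ v.asIdeal →
        cl m ∈ selmerLocalKer (W.baseChange K) (v.adicCompletion K) ((2 ^ M : ℕ) : ℤ)) ∧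
      (∀ ℓ : ℕ, ℓ.Prime → ℓ ∣ m → ∀ v : HeightOneSpectrum (𝓞 K), (ℓ : 𝓞 K) ∈ v.asIdeal →
        ∀ a : ℕ, ((((2 : ℕ) : ℤ) ^ a) • cl m ∈
            selmerLocalKer (W.baseChange K) (v.adicCompletion K) ((2 ^ M : ℕ) : ℤ) ↔
          (((2 : ℕ) : ℤ) ^ a) • cl (m / ℓ) ∈
            (W.baseChange K).torsionLocalKer (v.adicCompletion K) ((2 ^ M : ℕ) : ℤ))))
    (hrig : ∀ ℓ : ℕ, IsKolyvaginPrime N W K 2 ℓ ∧ FrobEqFrobInfty W K (2 ^ M) ℓ →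
      ∀ ν : ℤ, (ν = 1 ∨ ν = -1) → ∀ d : galH1Torsion (W.baseChange K) ((2 ^ M : ℕ) : ℤ),
      conjAct W c _ d = ν • d →
      (∀ v : HeightOneSpectrum (𝓞 K), (ℓ : 𝓞 K) ∉ v.asIdeal →
        d ∈ selmerLocalKer (W.baseChange K) (v.adicCompletion K) ((2 ^ M : ℕ) : ℤ)) →
      (∀ w : InfinitePlace K, d ∈ selmerLocalKer (W.baseChange K) w.Completion ((2 ^ M : ℕ) : ℤ)) →
      ∀ s ∈ selmerGroup (W.baseChange K) ((2 ^ M : ℕ) : ℤ), (2 : ℤ) • s = 0 →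
      ∀ v : HeightOneSpectrum (𝓞 K), (ℓ : 𝓞 K) ∈ v.asIdeal →
        (((2 : ℕ) : ℤ) ^ (M - 1)) • d ∉
          selmerLocalKer (W.baseChange K) (v.adicCompletion K) ((2 ^ M : ℕ) : ℤ) →
        s - conjAct W c _ s ∈
          (W.baseChange K).torsionLocalKer (v.adicCompletion K) ((2 ^ M : ℕ) : ℤ))
    {s : galH1Torsion (W.baseChange K) ((2 ^ M : ℕ) : ℤ)}
    (hs : s ∈ selmerGroup (W.baseChange K) ((2 ^ M : ℕ) : ℤ)) (h2s : (2 : ℤ) • s = 0) :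
    conjAct W c _ s = s := by
  -- `E(K)[2] = 0`
  have hA : ∀ a : (W.baseChange K).toAffine.Point, 2 • a = 0 → a = 0 := hA2
  -- the distinguished class `x = δ_M P`, a `c`-eigenclass (Gross Prop. 5.3 + `E(K)[2] = 0`)
  set x := kummerMapTorsion (W.baseChange K) _ hdiv P with hxdef
  have hτx : conjAct W c _ x = ε • x := by
    rw [hxdef, conjAct_kummerMapTorsion W c _ hdiv P]
    set t := Affine.Point.map (W' := W) (c : K →ₐ[ℚ] K) P - ε • P with ht
    obtain ⟨s₀, hs₀⟩ := exists_pow_smul_eq_of_isOfFinAddOrder Nat.prime_two hA h53 M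
    have hker : t ∈ (kummerMapTorsion (W.baseChange K) ((2 ^ M : ℕ) : ℤ) hdiv).ker := by
      rw [kummerMapTorsion_ker]
      exact ⟨s₀, by rw [← hs₀, Nat.cast_pow]; rfl⟩
    have ht0 : kummerMapTorsion (W.baseChange K) _ hdiv t = 0 := hker
    have : Affine.Point.map (W' := W) (c : K →ₐ[ℚ] K) P = t + ε • P := by rw [ht]; abel
    rw [this, map_add, ht0, zero_add, map_zsmul]
  -- the local conditions at the (complex) infinite places are empty
  have hinf : ∀ (w : InfinitePlace K) (y : galH1Torsion (W.baseChange K) ((2 ^ M : ℕ) : ℤ)),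
      y ∈ selmerLocalKer (W.baseChange K) w.Completion ((2 ^ M : ℕ) : ℤ) := fun w y ↦ by
    haveI : IsAlgClosed w.Completion :=
      isAlgClosed_of_ringEquiv (InfinitePlace.Completion.ringEquivComplexOfIsComplex
        (hK.2.isComplex w)).symm
    rw [WeierstrassCurve.selmerLocalKer_eq_top_of_isAlgClosed]
    trivial
  -- the anti-symmetrisation `d = s − c_* s`: a `(−1)`-eigenclass with `2d = 0`
  set d := s - conjAct W c _ s with hddef
  have hτd : conjAct W c _ d = (-1 : ℤ) • d := by
    rw [hddef, map_sub, conjAct_conjAct_of_mul_self W hcc, neg_one_zsmul, neg_sub]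
  have h2d : (2 : ℤ) • d = 0 := by
    rw [hddef, zsmul_sub, ← map_zsmul, h2s, map_zero, sub_zero]
  have h2d' : ((2 : ℤ) ^ 1) • d = 0 := by rw [pow_one]; exact h2d
  -- `d` is locally trivial at every TYPE-I Kolyvagin prime of level `M`
  have hloc : ∀ ℓ : ℕ, IsKolyvaginPrime N W K 2 ℓ ∧ FrobEqFrobInfty W K (2 ^ M) ℓ →
      ∀ v : HeightOneSpectrum (𝓞 K), (ℓ : 𝓞 K) ∈ v.asIdeal →
      (((2 : ℕ) : ℤ) ^ (M - 1)) • x ∉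
        (W.baseChange K).torsionLocalKer (v.adicCompletion K) ((2 ^ M : ℕ) : ℤ) →
      d ∈ (W.baseChange K).torsionLocalKer (v.adicCompletion K) ((2 ^ M : ℕ) : ℤ) := by
    intro ℓ hℓ v hv hxv
    have hsq : Squarefree ℓ := hℓ.1.prime.squarefree
    have hpf : ∀ q ∈ ℓ.primeFactors,
        IsKolyvaginPrime N W K 2 q ∧ FrobEqFrobInfty W K (2 ^ M) q := by
      intro q hq
      rw [hℓ.1.prime.primeFactors, Finset.mem_singleton] at hq
      subst hq
      exact hℓ
    obtain ⟨hτc, hcoff, hciff⟩ := hcl ℓ hsq hpf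
    have hν : ∃ ν : ℤ, (ν = 1 ∨ ν = -1) ∧ conjAct W c _ (cl ℓ) = ν • cl ℓ := by
      refine ⟨ε * (-1) ^ ℓ.primeFactors.card, ?_, hτc⟩
      rcases hε with rfl | rfl <;> rcases neg_one_pow_eq_or ℤ ℓ.primeFactors.card with h | h <;>
        simp [h]
    obtain ⟨ν, hν, hτcν⟩ := hν
    -- type I for `cl ℓ`: `2^{M-1} cl ℓ` is not Selmer-local at `λ`, as `2^{M-1} cl 1 = 2^{M-1} x` is not
    have hfull : (((2 : ℕ) : ℤ) ^ (M - 1)) • cl ℓ ∉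
        selmerLocalKer (W.baseChange K) (v.adicCompletion K) ((2 ^ M : ℕ) : ℤ) := by
      intro h
      have key := (hciff ℓ hℓ.1.prime (dvd_refl ℓ) v hv (M - 1)).mp h
      rw [Nat.div_self hℓ.1.prime.pos, hc1] at key
      exact hxv key
    exact hrig ℓ hℓ ν hν (cl ℓ) hτcν hcoff (fun w ↦ hinf w (cl ℓ)) s hs h2s v hv hfull
  -- `x` has order exactly `2^M`
  have hx0 : x ≠ 0 := fun h ↦ hxord (by rw [h, zsmul_zero])
  have hxM : ((2 : ℤ) ^ M) • x = 0 := by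
    have := zsmul_galH1Torsion_eq_zero (W.baseChange K) ((2 ^ M : ℕ) : ℤ) x
    exact_mod_cast this
  have hordx : addOrderOf x = 2 ^ M := by
    obtain ⟨e, -, heM, -, hemin, horde⟩ :=
      exists_addOrderOf_eq_pow (W.baseChange K) Nat.prime_two M hx0
    have heq : e = M := by
      by_contra hne
      have hlt : e < M := lt_of_le_of_ne heM hne
      apply hxord
      have h0 : ((2 : ℤ) ^ e) • x = 0 := by
        have h1 : ((2 ^ e : ℕ) : ℤ) • x = 0 := by
          rw [natCast_zsmul, ← horde]; exact addOrderOf_nsmul_eq_zero x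
        exact_mod_cast h1
      have h2 : (((2 : ℕ) : ℤ) ^ (M - 1)) • x = ((2 : ℤ) ^ (M - 1 - e)) • (((2 : ℤ) ^ e) • x) := by
        rw [smul_smul, ← pow_add, show M - 1 - e + e = M - 1 by omega]
        push_cast
        rfl
      rw [h2, h0, zsmul_zero]
    rw [horde, heq]
  have hdvdx : ∀ a : ℤ, a • x = 0 → (2 : ℤ) ^ M ∣ a := fun a ha ↦ by
    have h := addOrderOf_dvd_iff_zsmul_eq_zero.mpr ha
    rw [hordx] at h
    exact_mod_cast h
  have hKol : ∀ {ℓ : ℕ}, ℓ.Prime → ¬ ℓ ∣ N → ¬ ((ℓ : ℤ) ∣ NumberField.discr K) → ℓ ≠ 2 →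
      (Ideal.span {(ℓ : 𝓞 K)}).IsPrime → FrobEqFrobInfty W K (2 ^ M) ℓ →
      IsKolyvaginPrime N W K 2 ℓ := fun hℓ hℓN hℓD hℓp hprime hfrob ↦
    ⟨hℓ, hℓN, hℓD, hℓp, hprime, hfrob.of_dvd (dvd_pow_self 2 (by omega))⟩
  have e2 : (2 : ℤ) ^ M = 2 * 2 ^ (M - 1) := by rw [← pow_succ', Nat.sub_add_cancel hM]
  by_contra hne
  have hd0 : d ≠ 0 := fun h ↦ hne (sub_eq_zero.mp h).symm
  by_cases hspan : ∃ k : ℤ, d = k • x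
  · -- `d ∈ ℤx`: then `d = 2^{M-1} x`, and a type-I prime for `x` alone kills it
    obtain ⟨k, hk⟩ := hspan
    -- `2k x = 0`, so `2^M ∣ 2k`, `k = 2^{M-1} k'`, and `k'` is odd as `d ≠ 0`
    have h2k : (2 * k) • x = 0 := by rw [mul_zsmul, ← hk]; exact h2d
    have hk' : (2 : ℤ) ^ (M - 1) ∣ k := by
      have h := hdvdx _ h2k
      rw [e2] at h
      exact Int.dvd_of_mul_dvd_mul_left two_ne_zero h
    obtain ⟨k', rfl⟩ := hk'
    have hk'odd : ¬ (2 : ℤ) ∣ k' := by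
      rintro ⟨k'', rfl⟩
      apply hd0
      rw [hk, show (2 : ℤ) ^ (M - 1) * (2 * k'') = k'' * 2 ^ M by rw [e2]; ring, mul_zsmul, hxM,
        zsmul_zero]
    obtain ⟨j, hj⟩ := Int.not_even_iff_odd.mp (fun h ↦ hk'odd (even_iff_two_dvd.mp h))
    have hd' : d = (((2 : ℕ) : ℤ) ^ (M - 1)) • x := by
      rw [hk, hj, show (2 : ℤ) ^ (M - 1) * (2 * j + 1) = j * 2 ^ M + 2 ^ (M - 1) by rw [e2]; ring,
        add_zsmul, mul_zsmul, hxM, zsmul_zero, zero_add]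
      push_cast
      rfl
    -- Cor. 3.2 at `2` for `{x}` with `N = M`: a type-I prime
    obtain ⟨ℓ, -, hℓ, hℓN, hℓD, hℓp, hprime, hfrob, hlocℓ⟩ :=
      exists_kolyvaginPrime_gt_twoPow_holds (N := N) W hCW hK hcube hωK hM hc ![x]
        (fun i ↦ by fin_cases i; exact ⟨ε, hε, hτx⟩) ![M] (fun i ↦ by fin_cases i; exact hxM)
        (fun a ha i ↦ by
          have ha' : a 0 • x = 0 := by simpa [Fin.sum_univ_one] using ha
          fin_cases i
          exact hdvdx _ ha')
        ![M] (fun i ↦ by fin_cases i; exact le_rfl) (fun i ↦ by fin_cases i; exact le_rfl) 0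
    have hK₀ := hKol hℓ hℓN hℓD hℓp hprime hfrob
    have hxv : (((2 : ℕ) : ℤ) ^ (M - 1)) • x ∉
        (W.baseChange K).torsionLocalKer (hK₀.place.adicCompletion K) ((2 ^ M : ℕ) : ℤ) := by
      have h := (hlocℓ 0 hK₀.place hK₀.mem_place).2 (show M ≠ 0 by omega)
      exact_mod_cast h
    exact hxv (hd' ▸ hloc ℓ ⟨hK₀, hfrob⟩ hK₀.place hK₀.mem_place hxv)
  · -- `{x, d}` independent: Cor. 3.2 at `2` with `N = (M, 1)`
    push Not at hspan
    have hind : ∀ a : Fin 2 → ℤ, ∑ i, a i • (![x, d] i) = 0 → ∀ i, ((2 : ℤ) ^ (![M, 1] i)) ∣ a i := by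
      intro a ha
      have ha' : a 0 • x + a 1 • d = 0 := by simpa [Fin.sum_univ_two] using ha
      -- `a 1` must be even (else `d ∈ ℤx`), then `2^M ∣ a 0`
      have ha1 : (2 : ℤ) ∣ a 1 := by
        by_contra hodd
        obtain ⟨j, hj⟩ := Int.not_even_iff_odd.mp (fun h ↦ hodd (even_iff_two_dvd.mp h))
        apply hspan (-(a 0))
        -- `d = (2j+1) • d = a 1 • d = -(a 0) • x`
        have h1 : a 1 • d = d := by
          rw [hj, add_zsmul, one_zsmul, mul_comm, mul_zsmul, h2d, zsmul_zero, zero_add]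
        rw [← h1, neg_zsmul, eq_neg_iff_add_eq_zero, add_comm, ha']
      have ha1d : a 1 • d = 0 := by
        obtain ⟨a₁, ha₁⟩ := ha1
        rw [ha₁, mul_comm, mul_zsmul, h2d, zsmul_zero]
      have ha0 : a 0 • x = 0 := by rwa [ha1d, add_zero] at ha'
      intro i
      fin_cases i
      · exact hdvdx _ ha0
      · show (2 : ℤ) ^ 1 ∣ a 1
        rw [pow_one]; exact ha1
    obtain ⟨ℓ, -, hℓ, hℓN, hℓD, hℓp, hprime, hfrob, hlocℓ⟩ :=
      exists_kolyvaginPrime_gt_twoPow_holds (N := N) W hCW hK hcube hωK hM hc ![x, d]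
        (fun i ↦ by
          fin_cases i
          · exact ⟨ε, hε, hτx⟩
          · exact ⟨-1, Or.inr rfl, hτd⟩)
        ![M, 1]
        (fun i ↦ by
          fin_cases i
          · exact hxM
          · exact h2d')
        hind ![M, 1] (fun i ↦ by fin_cases i <;> exact le_rfl)
        (fun i ↦ by
          fin_cases i
          · exact le_rfl
          · exact hM) 0
    have hK₀ := hKol hℓ hℓN hℓD hℓp hprime hfrob
    have hxv : (((2 : ℕ) : ℤ) ^ (M - 1)) • x ∉
        (W.baseChange K).torsionLocalKer (hK₀.place.adicCompletion K) ((2 ^ M : ℕ) : ℤ) := by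
      have h := (hlocℓ 0 hK₀.place hK₀.mem_place).2 (show M ≠ 0 by omega)
      exact_mod_cast h
    have hdv : d ∉ (W.baseChange K).torsionLocalKer (hK₀.place.adicCompletion K)
        ((2 ^ M : ℕ) : ℤ) := by
      have h := (hlocℓ 1 hK₀.place hK₀.mem_place).2 (show (1 : ℕ) ≠ 0 by omega)
      have h' : ((2 : ℤ) ^ (1 - 1)) • d = d := by rw [Nat.sub_self, pow_zero, one_zsmul]
      exact fun hmem ↦ h (by rw [show (![x, d] : Fin 2 → _) 1 = d from rfl,
        show (![M, 1] : Fin 2 → ℕ) 1 = 1 from rfl, h']; exact hmem)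
    exact hdv (hloc ℓ ⟨hK₀, hfrob⟩ hK₀.place hK₀.mem_place hxv)

end Summit.BirchSwinnertonDyer.BirchSwinnertonDyer.Theorems.SylvesterTwoUpper

end
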